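import Summits.ResolutionOfSingularities.ResolutionOfSingularities.Theorems.PurelyInseparableDim4PureLeafLegality
import Summits.ResolutionOfSingularities.ResolutionOfSingularities.Theorems.PurelyInseparableDim4WinCertF
import HarnessLib
import HarnessLib.Audit.Tags

/-!
# Purely inseparable fourfolds — PURE LEAVES WITH EXACTLY ONE ODD EXPONENT WIN THE GLOBAL GAME over `𝔽₂`
# (cell res-dim4-pi; D3b, the one-odd-entry case of `PureLeafGlobalWinQuestion`, ALL exponents)
# [OURS · counted 0 · a theorem about OUR coordinate-centre frame v4, not about resolution]

Width seat `res-dim4-p-10` (g2).  First INFINITE family of the D3b question settled in the kernel: if the exponent vector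
`a` has EXACTLY ONE odd entry `k`, then every booking of the pure leaf `x^a` is an A-win of the PLAIN GLOBAL game over
`𝔽₂` at `q = 2` (`StateWins 2`; tree `Edge`, along-centre replies included), A playing a singleton centre `{x_j}` with
`a_j ≥ 2` (MODE 1h).  Invariant (memo §3 with `|Odd| = 1`): along the whole play the state is a product
`N(a,e) = ∏ xᵢ^{aᵢ}(1+xᵢ)^{eᵢ}` in which `k` is of type A (`a_k` odd, `e_k` even) and every other variable of type C (both
even); a reply either keeps `k` untranslated — the cleaning deletes nothing (`step_F_of_purelyOdd`) — or swaps it to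
`(even, odd)`, and then the cleaning re-creates a type-A variable at `k`: `F′ = N(a′, ê)·x_k` (`step_F_of_forall_even`,
`prod_sub_eq_mul_L` with `T₁ = {k}`); the measure `Σ (aᵢ + eᵢ)` drops by `2` at every move; no pair move and no L-state
ever occurs.

* `stateWins_prod_oneOdd` — the invariant class is winning (strong induction on `Σ (aᵢ + eᵢ)`);
* **`stateWins_monomial_oneOdd`** — `∀ r exc, StateWins 2 ⟨x^a, r, exc⟩` for every `a : Fin 4 → ℕ` with exactly one
  odd entry; `inScopeStateWins_monomial_oneOdd`.

Riders: `𝔽₂`-rational replies (the game over `ZMod 2`); nothing here proves resolution of singularities in dimension ≥ 4 /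
characteristic `p`; counted 0; AI work, weaker than expert review. bears_on: LADDER-RESOLUTION:D157-DOOR2 (res-dim4-pi ·
WORD #60 D3b). Supports stmt-ResolutionOfSingularities-16155 (helper).
-/

set_option linter.dupNamespace false

open MvPolynomial Finset

open scoped BigOperators

noncomputable section

namespace Summit.ResolutionOfSingularities.ResolutionOfSingularities.Theorems.PIDim4

namespace PureLeafNF

open Literature.AlgebraicGeometry.Resolution
open Literature.AlgebraicGeometry.Resolution.Hauser2010
open CentreBlowup PthPowerFactor

/-! ## 1. Small arithmetic of the chart-and-swap -/

/-- The measure drops by `2`: `Σ (a′ + e′) = Σ (a + e) − 2` for the chart-and-swap of a singleton move (`2 ≤ a_j`). [folklore] -/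
theorem sum_chartSwap (a e : Fin 4 → ℕ) {j : Fin 4} (hj : 2 ≤ a j) (b : Fin 4 → ZMod 2) :
    (∑ i, ((if b i = 0 then Function.update a j (a j - 2) i else e i) +
        (if b i = 0 then e i else Function.update a j (a j - 2) i))) + 2 = ∑ i, (a i + e i) := by
  have hpt : ∀ i, (if b i = 0 then Function.update a j (a j - 2) i else e i) +
      (if b i = 0 then e i else Function.update a j (a j - 2) i) = Function.update a j (a j - 2) i + e i := by
    intro i; split_ifs <;> ring
  simp_rw [hpt, Finset.sum_add_distrib]
  have hsplit := Finset.add_sum_erase Finset.univ a (Finset.mem_univ j)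
  have hsplit' := Finset.add_sum_erase Finset.univ (Function.update a j (a j - 2)) (Finset.mem_univ j)
  have hrest : ∑ i ∈ Finset.univ.erase j, Function.update a j (a j - 2) i = ∑ i ∈ Finset.univ.erase j, a i :=
    Finset.sum_congr rfl fun i hi => by rw [Function.update_of_ne (Finset.ne_of_mem_erase hi)]
  rw [Function.update_self] at hsplit'
  omega

/-- `x_k = N(δ_k, 0)`. [folklore] -/
theorem X_eq_prod (k : Fin 4) :
    (X k : MvPolynomial (Fin 4) (ZMod 2)) = ∏ i, X i ^ (if i = k then 1 else 0) * (1 + X i) ^ (0 : ℕ) := by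
  rw [← Finset.mul_prod_erase Finset.univ _ (Finset.mem_univ k), if_pos rfl, pow_one, pow_zero, mul_one,
    Finset.prod_eq_one fun i hi => ?_, mul_one]
  rw [if_neg (Finset.ne_of_mem_erase hi), pow_zero, pow_zero, mul_one]

/-! ## 2. The invariant class is winning -/

/-- **One type-A variable, all others even ⇒ A wins.** For `N(a,e)` over `𝔽₂` with `a_k` odd, `e_k` even and all other
`aᵢ, eᵢ` even, every booking is in A's attractor of the plain global game. [OURS · counted 0] [folklore] -/
theorem stateWins_prod_oneOdd : ∀ (n : ℕ) (a e : Fin 4 → ℕ) (k : Fin 4), ∑ i, (a i + e i) ≤ n →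
    a k % 2 = 1 → e k % 2 = 0 → (∀ i, i ≠ k → a i % 2 = 0 ∧ e i % 2 = 0) →
    ∀ (r : Fin 4 →₀ ℕ) (exc : Finset (Fin 4)),
      StateWins 2 (⟨∏ i, X i ^ a i * (1 + X i) ^ e i, r, exc⟩ : State (ZMod 2)) := by
  intro n
  induction n using Nat.strong_induction_on with
  | _ n IH =>
  intro a e k hn hak hek hC r exc
  -- the state and its leaf data
  set s : State (ZMod 2) := ⟨∏ i, X i ^ a i * (1 + X i) ^ e i, Finsupp.equivFunOnFinite.symm a, exc⟩ with hs
  have hdiv : ∀ d ∈ s.F.support, s.r ≤ d := fun d hd => le_of_mem_support_prod a e hd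
  have hd0 : coeff s.r s.F ≠ 0 := by
    change coeff (Finsupp.equivFunOnFinite.symm a) (∏ i, X i ^ a i * (1 + X i) ^ e i) ≠ 0
    rw [coeff_self_prod]; exact one_ne_zero
  have hord : ∀ S : Finset (Fin 4), ordAlong S s.F = (degIn S (Finsupp.equivFunOnFinite.symm a) : ℕ∞) :=
    fun S => LeafStep.ordAlong_eq_degIn S s hdiv hd0
  -- books do not matter: prove it for the booking `(a, exc)` and re-book
  suffices hwin : StateWins 2 s by
    have := WinCertF.stateWins_rebook hwin r exc
    exact this
  unfold StateWins
  by_cases hsmall : ∑ i, a i ≤ 1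
  · -- no permissible centre: terminal win
    refine Game.Wins.terminal fun S hS => ?_
    have h2 : (2 : ℕ∞) ≤ ordAlong S s.F := hS.2
    rw [hord S] at h2
    have h3 : degIn S (Finsupp.equivFunOnFinite.symm a) ≤ ∑ i, a i := by
      unfold degIn
      exact Finset.sum_le_sum_of_subset_of_nonneg (Finset.subset_univ S) fun i _ _ => Nat.zero_le _
    have h4 : (2 : ℕ) ≤ degIn S (Finsupp.equivFunOnFinite.symm a) := by exact_mod_cast h2
    omega
  · -- a singleton centre `{x_j}` with `2 ≤ a_j` exists
    rw [not_le] at hsmall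
    obtain ⟨j, hj⟩ : ∃ j, 2 ≤ a j := by
      by_contra hno
      push Not at hno
      -- all `a i ≤ 1`; the even ones are `0`, so `Σ a = a k ≤ 1`
      have hsum := Finset.add_sum_erase Finset.univ a (Finset.mem_univ k)
      have hrest : ∑ i ∈ Finset.univ.erase k, a i = 0 :=
        Finset.sum_eq_zero fun i hi => by
          have h1 := hno i; have h2 := (hC i (Finset.ne_of_mem_erase hi)).1; omega
      have := hno k
      omega
    refine Game.Wins.move (m := ({j} : Finset (Fin 4))) ⟨Finset.singleton_nonempty j, ?_⟩ ?_
    · rw [hord {j}, degIn_singleton]; exact_mod_cast hj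
    rintro s' ⟨j', b, hj', hbj, heq, hne, rfl⟩
    rw [Finset.mem_singleton] at hj'
    subst hj'
    -- the new exponents
    set a' : Fin 4 → ℕ := fun i => if b i = 0 then Function.update a j' (a j' - 2) i else e i with ha'
    set e' : Fin 4 → ℕ := fun i => if b i = 0 then e i else Function.update a j' (a j' - 2) i with he'
    have hmeas : (∑ i, (a' i + e' i)) + 2 = ∑ i, (a i + e i) := sum_chartSwap a e hj b
    have hF : s.F = ∏ i, X i ^ a i * (1 + X i) ^ e i := rfl
    -- parities of the new exponents
    have hupd : ∀ i, Function.update a j' (a j' - 2) i % 2 = a i % 2 := fun i => by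
      by_cases hij : i = j'
      · subst hij; rw [Function.update_self]; omega
      · rw [Function.update_of_ne hij]
    have hCa' : ∀ i, i ≠ k → a' i % 2 = 0 := fun i hi => by
      simp only [ha']; split_ifs
      · rw [hupd]; exact (hC i hi).1
      · exact (hC i hi).2
    have hCe' : ∀ i, i ≠ k → e' i % 2 = 0 := fun i hi => by
      simp only [he']; split_ifs
      · exact (hC i hi).2
      · rw [hupd]; exact (hC i hi).1
    -- re-book the successor: it suffices to win from `⟨F′, books⟩` for the books of the step
    change Game.Wins _ _ (step 2 {j'} j' b s)
    have hstate : step 2 {j'} j' b s = ⟨(step 2 {j'} j' b s).F, (step 2 {j'} j' b s).r, (step 2 {j'} j' b s).exc⟩ := rfl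
    rw [hstate]
    by_cases hbk : b k = 0
    · -- (α) `k` untranslated: purely odd survives, the cleaning deletes nothing
      have hak' : a' k % 2 = 1 := by simp only [ha', hbk, if_true]; rw [hupd]; exact hak
      have hek' : e' k % 2 = 0 := by simp only [he', hbk, if_true]; exact hek
      have hF' : (step 2 {j'} j' b s).F = ∏ i, X i ^ a' i * (1 + X i) ^ e' i :=
        step_F_of_purelyOdd s a e hF hj b (k := k) hak' hek'
      rw [hF']
      exact IH (∑ i, (a' i + e' i)) (by omega) a' e' k le_rfl hak' hek' (fun i hi => ⟨hCa' i hi, hCe' i hi⟩) _ _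
    · -- (β) `k` swapped to (even, odd): every `a′` is even; the cleaning re-creates `x_k`
      have hkj : k ≠ j' := fun h => hbk (h ▸ hbj)
      have hak' : a' k % 2 = 0 := by simp only [ha', hbk, if_false]; exact hek
      have hek' : e' k % 2 = 1 := by simp only [he', hbk, if_false]; rw [hupd]; exact hak
      have hall : ∀ i, a' i % 2 = 0 := fun i => by
        by_cases hik : i = k
        · rw [hik]; exact hak'
        · exact hCa' i hik
      have hF' : (step 2 {j'} j' b s).F =
          (∏ i, X i ^ a' i * (1 + X i) ^ e' i) - ∏ i, X i ^ a' i * (1 + X i) ^ (e' i - e' i % 2) :=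
        step_F_of_forall_even s a e hF hj b hall
      -- the odd-`e′` set is `{k}`
      have hfilter : Finset.univ.filter (fun i => e' i % 2 = 1) = {k} := by
        ext i
        simp only [Finset.mem_filter, Finset.mem_univ, true_and, Finset.mem_singleton]
        constructor
        · intro h; by_contra hik; have := hCe' i hik; omega
        · intro h; rw [h]; exact hek'
      have hL : (∏ i ∈ Finset.univ.filter (fun i => e' i % 2 = 1), (1 + X i : MvPolynomial (Fin 4) (ZMod 2))) - 1 = X k := by
        rw [hfilter, Finset.prod_singleton]; ring
      -- `F′ = N(a′, ê) · x_k = N(a′ + δ_k, ê)`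
      have hF'' : (step 2 {j'} j' b s).F =
          ∏ i, X i ^ (a' i + (if i = k then 1 else 0)) * (1 + X i) ^ ((e' i - e' i % 2) + 0) := by
        rw [hF', prod_sub_eq_mul_L, hL, X_eq_prod k, prod_mul_prod]
      rw [hF'']
      refine IH (∑ i, ((a' i + (if i = k then 1 else 0)) + ((e' i - e' i % 2) + 0))) ?_ _ _ k le_rfl ?_ ?_ ?_ _ _
      · -- measure: `Σ (a′ + δ_k + ê) = Σ (a′ + e′) ≤ n − 2`
        have h1 : ∑ i, ((a' i + (if i = k then 1 else 0)) + ((e' i - e' i % 2) + 0)) + 2 ≤ ∑ i, (a' i + e' i) + 2 := by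
          have hk1 : ∑ i, (if i = k then 1 else 0 : ℕ) = 1 := by
            rw [Finset.sum_ite_eq' Finset.univ k (fun _ => (1 : ℕ)), if_pos (Finset.mem_univ k)]
          have hê : ∑ i, ((e' i - e' i % 2) + 0) + 1 ≤ ∑ i, e' i := by
            have := Finset.add_sum_erase Finset.univ (fun i => (e' i - e' i % 2) + 0) (Finset.mem_univ k)
            have h' := Finset.add_sum_erase Finset.univ e' (Finset.mem_univ k)
            have hle : ∑ i ∈ Finset.univ.erase k, ((e' i - e' i % 2) + 0) ≤ ∑ i ∈ Finset.univ.erase k, e' i :=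
              Finset.sum_le_sum fun i _ => by omega
            have hkk : (e' k - e' k % 2) + 0 + 1 ≤ e' k := by omega
            omega
          rw [Finset.sum_add_distrib, Finset.sum_add_distrib, hk1]
          have := Finset.sum_add_distrib (s := Finset.univ) (f := a') (g := e')
          omega
        omega
      · rw [if_pos rfl]; omega
      · omega
      · intro i hi
        rw [if_neg hi, add_zero, add_zero]
        refine ⟨hCa' i hi, ?_⟩
        have := hCe' i hi; omega

/-! ## 3. Pure leaves with exactly one odd exponent -/

/-- **EVERY PURE LEAF WITH EXACTLY ONE ODD EXPONENT WINS THE GLOBAL GAME OVER `𝔽₂`** (all exponents, every booking):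
`StateWins 2 ⟨x^a, r, exc⟩`. [OURS · counted 0] [folklore] -/
theorem stateWins_monomial_oneOdd (a : Fin 4 → ℕ) (k : Fin 4) (hak : a k % 2 = 1)
    (hC : ∀ i, i ≠ k → a i % 2 = 0) (r : Fin 4 →₀ ℕ) (exc : Finset (Fin 4)) :
    StateWins 2 (⟨monomial (Finsupp.equivFunOnFinite.symm a) 1, r, exc⟩ : State (ZMod 2)) := by
  have hN : (monomial (Finsupp.equivFunOnFinite.symm a) (1 : ZMod 2)) =
      ∏ i, X i ^ a i * (1 + X i) ^ (fun _ => (0 : ℕ)) i := by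
    rw [prod_eq_monomial_mul]; simp
  rw [hN]
  exact stateWins_prod_oneOdd _ a (fun _ => 0) k le_rfl hak rfl (fun i hi => ⟨hC i hi, rfl⟩) r exc

/-- … hence in-scope escapable (F4-C attractor) for every booking. [OURS · counted 0] [folklore] -/
theorem inScopeStateWins_monomial_oneOdd (a : Fin 4 → ℕ) (k : Fin 4) (hak : a k % 2 = 1)
    (hC : ∀ i, i ≠ k → a i % 2 = 0) (r : Fin 4 →₀ ℕ) (exc : Finset (Fin 4)) :
    InScopeWinCert.InScopeStateWins 2
      (⟨monomial (Finsupp.equivFunOnFinite.symm a) 1, r, exc⟩ : State (ZMod 2)) :=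
  InScopeWinCert.inScopeStateWins_of_stateWins (stateWins_monomial_oneOdd a k hak hC r exc)

end PureLeafNF

end Summit.ResolutionOfSingularities.ResolutionOfSingularities.Theorems.PIDim4

end
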